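import Summits.AtomisticToContinuum.Crystallization.Theorems.OverbindingBudgetAffineCompressedCutEstablish

/-!
# `OverbindingBudget` / crux `RobustDefectLimitWindows` (stmt-AtomisticToContinuum-31280) — «RunCut»: THE ATLAS AXIS LINK (two stacking data at one h-site have one axis)

Support file (lens-4 g87, part 10; memo `g87/memo/SW-CHI.md` §10.3, order (2b) — the pattern-level core of the ATLAS-GLUING lemma).  In the re-based layer-rigidity
atlas (`…RunCutRebase.layer_rigidity_rebase_charts`) every established site `m` of a ball with base `i` comes with an isometry `M` that CARRIES m's own pattern `P m`
onto the level's aligned copy `C ∈ [fccL, fccNegL, hcpL, hcpAltL]` and a frame link `‖ν_m • A m x − B (M x)‖ ≤ τ‖x‖` to the datum frame `B` («Establish».`Estab`).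
When `m` is an h-site (`P m = hcpTwoShellPattern`) and is established in TWO data (bases `i₁`, `i₂`, frames `B₁`, `B₂`), the two layer normals agree:

* §1 (`decide` over the integer lists) `hcp_copies_sub_eq_444` (in `H` and `H′ = −H` a pair at squared distance `48` differs by `±(4,4,4)`), `hcp_copies_pair_444`
  (each contains a pair with difference `(4,4,4)`), `fcc_copies_no_48` (no pair of `F⁺`, `F⁻` at squared distance `48`), `hcpL_pair_444`;
* §2 `carries_hcp_class` — an isometry cannot carry the hcp pattern onto `fccL`/`fccNegL` (the pattern has a pair at model distance² `48`, the fcc copies have none):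
  the class of an h-site's level is `hcpL` or `hcpAltL`;
* ★ `carries_axis` — two isometries carrying the hcp pattern onto copies in `{hcpL, hcpAltL}` agree on the AXIS up to sign: `M₁ x = mv (4,4,4) → M₂ x = ± mv (4,4,4)`
  (the eclipsed-pair fingerprint, (35h)(a), in chart form);
* ★★ `estab_axis_link` — two `Estab` records of one h-site: classes in `{hcpL, hcpAltL}` and `‖B₁ (mv (4,4,4)) ∓ B₂ (mv (4,4,4))‖ ≤ (τ₁ + τ₂)·‖mv (4,4,4)‖`, i.e. the
  images of the model axis under the two datum frames agree up to sign within `(τ₁ + τ₂)·√(8/3)` (record `τ = tauR ν 31 = 0.0242ν` each: ≈ 0.05 rad).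
fcc-only overlaps carry no such link (the sign class is free there) — none is claimed.
[this file: 0 definitions, 9 theorems; imports `…CompressedCutEstablish` only; standard axioms]
-/

namespace Summit.AtomisticToContinuum.Crystallization.Theorems.OverbindingBudgetAffineRunCutAtlasAxis

open Literature.Geometry.DiscreteGeometry (nearestDist fccTwoShellPattern hcpTwoShellPattern)
open Summit.AtomisticToContinuum.Crystallization.Theorems.OverbindingBudgetAffineCompressedCutKernel (T3 tsub tsq fccL fccNegL hcpL hcpAltL)
open Summit.AtomisticToContinuum.Crystallization.Theorems.OverbindingBudgetAffineCompressedCutKernel (tneg)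
open Summit.AtomisticToContinuum.Crystallization.Theorems.OverbindingBudgetAffineCompressedCutCharts (mv mv_tsub mv_tneg norm_mv_sq ListedBy Carries listedBy_hcp)
open Summit.AtomisticToContinuum.Crystallization.Theorems.OverbindingBudgetAffineCompressedCutEstablish (Estab)

variable {N : ℕ}

/-! ## §1 The integer facts (`decide`) -/

/-- In the aligned hcp copies `H`, `H′` a pair at squared distance `48` differs by `±(4,4,4)` (the eclipsed pairs ARE the axis). [this file · kind: computation] -/
theorem hcp_copies_sub_eq_444 : ∀ C ∈ [hcpL, hcpAltL], ∀ V ∈ C, ∀ W ∈ C,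
    tsq (tsub V W) = 48 → (tsub V W = (4, 4, 4) ∨ tsub V W = (-4, -4, -4)) := by
  decide

/-- Each aligned hcp copy contains a pair with difference `(4,4,4)`. [this file · kind: computation] -/
theorem hcp_copies_pair_444 : ∀ C ∈ [hcpL, hcpAltL], ∃ V ∈ C, ∃ W ∈ C, tsub V W = (4, 4, 4) := by
  decide

/-- `hcpL` itself: `(3,3,0) − (−1,−1,−4) = (4,4,4)`. [this file · kind: computation] -/
theorem hcpL_pair_444 : (3, 3, 0) ∈ hcpL ∧ (-1, -1, -4) ∈ hcpL ∧ tsub (3, 3, 0) (-1, -1, -4) = ((4, 4, 4) : T3) := by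
  decide

/-- No pair of the aligned fcc copies `F⁺`, `F⁻` has squared distance `48`. [this file · kind: computation] -/
theorem fcc_copies_no_48 : ∀ C ∈ [fccL, fccNegL], ∀ V ∈ C, ∀ W ∈ C, tsq (tsub V W) ≠ 48 := by
  decide

/-! ## §2 Charts of an h-site -/

/-- Norm transfer: `‖mv V − mv W‖ = ‖mv (4,4,4)‖` forces `tsq (V − W) = 48`. [this file · kind: glue] -/
theorem tsq_eq_48_of_norm_eq {V W : T3} (h : ‖mv V - mv W‖ = ‖mv (4, 4, 4)‖) : tsq (tsub V W) = 48 := by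
  rw [← mv_tsub] at h
  have h2 : ‖mv (tsub V W)‖ ^ 2 = ‖mv (4, 4, 4)‖ ^ 2 := by rw [h]
  rw [norm_mv_sq, norm_mv_sq] at h2
  have h48 : (tsq ((4, 4, 4) : T3) : ℝ) = 48 := by exact_mod_cast (show tsq ((4, 4, 4) : T3) = 48 by decide)
  rw [h48] at h2
  have h3 : (tsq (tsub V W) : ℝ) = 48 := by linarith
  exact_mod_cast h3

/-- **The class of an h-site's level is an hcp copy**: an isometry carrying the hcp two-shell pattern onto one of the four aligned copies carries it onto `H` or `H′`.
[this file · kind: proof] -/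
theorem carries_hcp_class {M : EuclideanSpace ℝ (Fin 3) →ₗᵢ[ℝ] EuclideanSpace ℝ (Fin 3)} {C : List T3}
    (hM : Carries M hcpTwoShellPattern C) (hC : C ∈ [fccL, fccNegL, hcpL, hcpAltL]) : C = hcpL ∨ C = hcpAltL := by
  obtain ⟨hv0, hw0, hsub⟩ := hcpL_pair_444
  have hv : mv (3, 3, 0) ∈ hcpTwoShellPattern := listedBy_hcp.2 _ hv0
  have hw : mv (-1, -1, -4) ∈ hcpTwoShellPattern := listedBy_hcp.2 _ hw0
  obtain ⟨V, hV, hMV⟩ := hM.1 _ hv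
  obtain ⟨W, hW, hMW⟩ := hM.1 _ hw
  have hnorm : ‖mv V - mv W‖ = ‖mv (4, 4, 4)‖ := by
    rw [← hMV, ← hMW, ← map_sub, M.norm_map, ← mv_tsub, hsub]
  have h48 := tsq_eq_48_of_norm_eq hnorm
  simp only [List.mem_cons, List.not_mem_nil, or_false] at hC
  rcases hC with rfl | rfl | rfl | rfl
  · exact absurd h48 (fcc_copies_no_48 fccL (by simp) V hV W hW)
  · exact absurd h48 (fcc_copies_no_48 fccNegL (by simp) V hV W hW)
  · exact Or.inl rfl
  · exact Or.inr rfl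

/-- ★ **TWO h-CHARTS HAVE ONE AXIS**: isometries `M₁`, `M₂` carrying the hcp two-shell pattern onto copies in `{H, H′}` satisfy `M₁ x = mv (4,4,4) → M₂ x = ± mv (4,4,4)`.
[this file · kind: proof] -/
theorem carries_axis {M₁ M₂ : EuclideanSpace ℝ (Fin 3) →ₗᵢ[ℝ] EuclideanSpace ℝ (Fin 3)} {C₁ C₂ : List T3}
    (h₁ : Carries M₁ hcpTwoShellPattern C₁) (h₂ : Carries M₂ hcpTwoShellPattern C₂) (hC₁ : C₁ ∈ [hcpL, hcpAltL]) (hC₂ : C₂ ∈ [hcpL, hcpAltL])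
    {x : EuclideanSpace ℝ (Fin 3)} (hx : M₁ x = mv (4, 4, 4)) : M₂ x = mv (4, 4, 4) ∨ M₂ x = mv (-4, -4, -4) := by
  obtain ⟨V, hV, W, hW, hVW⟩ := hcp_copies_pair_444 C₁ hC₁
  obtain ⟨v, hv, hMv⟩ := h₁.2 V hV
  obtain ⟨w, hw, hMw⟩ := h₁.2 W hW
  have hxvw : x = v - w := by
    apply M₁.injective
    rw [map_sub, hMv, hMw, ← mv_tsub, hVW, hx]
  obtain ⟨V', hV', hMv'⟩ := h₂.1 v hv
  obtain ⟨W', hW', hMw'⟩ := h₂.1 w hw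
  have hM₂x : M₂ x = mv (tsub V' W') := by rw [hxvw, map_sub, hMv', hMw', mv_tsub]
  have hnorm : ‖mv V' - mv W'‖ = ‖mv (4, 4, 4)‖ := by
    rw [← mv_tsub, ← hM₂x, M₂.norm_map, ← hx, M₁.norm_map]
  rcases hcp_copies_sub_eq_444 C₂ hC₂ V' hV' W' hW' (tsq_eq_48_of_norm_eq hnorm) with h | h
  · left; rw [hM₂x, h]
  · right; rw [hM₂x, h]

/-- Frame transfer: two frame links through a common frame map `L` put `B₁ (M₁ x)` and `B₂ (M₂ x)` within `(τ₁ + τ₂)‖x‖`. [this file · kind: glue] -/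
theorem frame_link_transfer (L : EuclideanSpace ℝ (Fin 3) → EuclideanSpace ℝ (Fin 3)) {B₁ B₂ : EuclideanSpace ℝ (Fin 3) →ₗ[ℝ] EuclideanSpace ℝ (Fin 3)}
    {M₁ M₂ : EuclideanSpace ℝ (Fin 3) →ₗᵢ[ℝ] EuclideanSpace ℝ (Fin 3)}
    {τ₁ τ₂ : ℝ} (h₁ : ∀ x, ‖L x - B₁ (M₁ x)‖ ≤ τ₁ * ‖x‖) (h₂ : ∀ x, ‖L x - B₂ (M₂ x)‖ ≤ τ₂ * ‖x‖) (x : EuclideanSpace ℝ (Fin 3)) :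
    ‖B₁ (M₁ x) - B₂ (M₂ x)‖ ≤ (τ₁ + τ₂) * ‖x‖ := by
  have h : B₁ (M₁ x) - B₂ (M₂ x) = (L x - B₂ (M₂ x)) - (L x - B₁ (M₁ x)) := by abel
  rw [h]
  calc ‖(L x - B₂ (M₂ x)) - (L x - B₁ (M₁ x))‖ ≤ ‖L x - B₂ (M₂ x)‖ + ‖L x - B₁ (M₁ x)‖ := norm_sub_le _ _
    _ ≤ τ₂ * ‖x‖ + τ₁ * ‖x‖ := add_le_add (h₂ x) (h₁ x)
    _ = (τ₁ + τ₂) * ‖x‖ := by ring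

/-- ★★ **THE ATLAS AXIS LINK.**  Two `Estab` records of ONE h-site `m` (bases `i₁`, `i₂`; datum frames `B₁`, `B₂`; classes among the four aligned copies): both classes are hcp
copies, and the images of the model axis vector `mv (4,4,4)` under the two datum frames agree UP TO SIGN within `(τ₁ + τ₂)·‖mv (4,4,4)‖`. [this file · kind: proof] -/
theorem estab_axis_link {y : Fin N → EuclideanSpace ℝ (Fin 3)} {A : Fin N → (EuclideanSpace ℝ (Fin 3) →ₗ[ℝ] EuclideanSpace ℝ (Fin 3))}
    {P : Fin N → Finset (EuclideanSpace ℝ (Fin 3))} {B₁ B₂ : EuclideanSpace ℝ (Fin 3) →ₗ[ℝ] EuclideanSpace ℝ (Fin 3)} {i₁ i₂ m : Fin N}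
    {M₁ M₂ : EuclideanSpace ℝ (Fin 3) →ₗᵢ[ℝ] EuclideanSpace ℝ (Fin 3)} {C₁ C₂ : List T3} {lam₁ lam₂ : T3} {τ₁ τ₂ D₁ D₂ : ℝ}
    (hE₁ : Estab y A P B₁ i₁ m M₁ C₁ lam₁ τ₁ D₁) (hE₂ : Estab y A P B₂ i₂ m M₂ C₂ lam₂ τ₂ D₂) (hm : P m = hcpTwoShellPattern)
    (hC₁ : C₁ ∈ [fccL, fccNegL, hcpL, hcpAltL]) (hC₂ : C₂ ∈ [fccL, fccNegL, hcpL, hcpAltL]) :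
    (C₁ = hcpL ∨ C₁ = hcpAltL) ∧ (C₂ = hcpL ∨ C₂ = hcpAltL) ∧
      (‖B₁ (mv (4, 4, 4)) - B₂ (mv (4, 4, 4))‖ ≤ (τ₁ + τ₂) * ‖mv (4, 4, 4)‖ ∨
        ‖B₁ (mv (4, 4, 4)) + B₂ (mv (4, 4, 4))‖ ≤ (τ₁ + τ₂) * ‖mv (4, 4, 4)‖) := by
  obtain ⟨hc₁, hl₁, -⟩ := hE₁
  obtain ⟨hc₂, hl₂, -⟩ := hE₂
  rw [hm] at hc₁ hc₂
  have hk₁ := carries_hcp_class hc₁ hC₁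
  have hk₂ := carries_hcp_class hc₂ hC₂
  have hC₁' : C₁ ∈ [hcpL, hcpAltL] := by rcases hk₁ with rfl | rfl <;> simp
  have hC₂' : C₂ ∈ [hcpL, hcpAltL] := by rcases hk₂ with rfl | rfl <;> simp
  refine ⟨hk₁, hk₂, ?_⟩
  -- a preimage of the model axis under `M₁` (isometries of `ℝ³` are onto)
  obtain ⟨x, hx⟩ : ∃ x, M₁ x = mv (4, 4, 4) := by
    refine ⟨(M₁.toLinearIsometryEquiv rfl).symm (mv (4, 4, 4)), ?_⟩
    have h := (M₁.toLinearIsometryEquiv rfl).apply_symm_apply (mv (4, 4, 4))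
    rwa [LinearIsometry.toLinearIsometryEquiv_apply] at h
  have hxn : ‖x‖ = ‖mv (4, 4, 4)‖ := by rw [← hx, M₁.norm_map]
  have hlink := frame_link_transfer (fun x => nearestDist y m • A m x) hl₁ hl₂ x
  rw [hx, hxn] at hlink
  rcases carries_axis hc₁ hc₂ hC₁' hC₂' hx with h | h
  · left; rwa [h] at hlink
  · right
    rw [h] at hlink
    have ht : tneg ((4, 4, 4) : T3) = (-4, -4, -4) := by decide
    have hneg : mv ((-4, -4, -4) : T3) = -mv (4, 4, 4) := by rw [← ht]; exact mv_tneg _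
    rw [hneg, map_neg, sub_neg_eq_add] at hlink
    exact hlink

end Summit.AtomisticToContinuum.Crystallization.Theorems.OverbindingBudgetAffineRunCutAtlasAxis
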